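import Literature.AlgebraicGeometry.Motives.AbelianVarietyFiniteOfFibreTranslate
import Literature.AlgebraicGeometry.Motives.AbelianVarietyTwoSmulSectionsCover
import Literature.AlgebraicGeometry.Motives.JacobianPrimeThetaDivisor
import Literature.AlgebraicGeometry.Motives.CartierDivisorMultiplicityOfIrreducibleSupport
import Literature.AlgebraicGeometry.Motives.AbelianVarietyTranslationLemma
import HarnessLib

/-!
# Mumford §6 Application 1 for an ARBITRARY effective divisor: finite set-stabiliser of `Supp D` ⇒ `D` ample

Layer `Literature/AlgebraicGeometry/Motives`, namespaces `….Motives.CartierDivisor` (§1) and `….Motives.AbelianVariety` (§2–§3).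
KERNEL ONLY: theorems, no definition, no named fact, no instance, no `sorry`.  Road G5 of the cell `hodgecm-mathlib` (row VI-7),
CAPITAL beside the three ★ bricks of (V7-c): (c-i) `Motives/AbelianVarietyTwoSmulSectionsCover` (`isAmple_of_isEffective_of_forall_isFinite`:
the linear-system half), (F) `Motives/AbelianVarietyFiniteOfFibreTranslate` (`isFinite_of_preimage_subset_translate_of_translationLemma`:
the finiteness half GRANTED the translation lemma (H)), and (H) `Motives/AbelianVarietyTranslationLemma` (the translation lemma for an
effective divisor with IRREDUCIBLE support).  The consumer of record (`Θ_W`, a prime divisor) only needs irreducible support; this file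
removes that hypothesis.

## The mathematics ([MumfordAV1970] §6 Application 1, pp. 60–61; [Hartshorne1977] II.6 Prop. 6.11)

Let `A` be an abelian variety over `k = k̄` and `D ≥ 0` a Cartier divisor with support `S = Supp D = A ∖ A_1`.  On the regular scheme
`A` the ideal sheaf `𝒪_A(−D)` is its divisorial part `∏_ζ 𝓘_{cl ζ}^{a_ζ}` over the finitely many codimension-one points `ζ` of `S`
(★ `Resolution/DivisorialPart`), so **`S = ⋃_ζ cl{ζ}`** is the union of the supports of the PRIME divisors `[cl ζ]` (§1).  Hence the
translation lemma (H) for divisors with irreducible support — «`Z ⊆ t_y⁻¹(A ∖ S′)` closed irreducible ⇒ `t_{zz′⁻¹}(S′) = S′` for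
`z, z′ ∈ Z(k)`» — applied to each `[cl ζ]` (whose complement contains `A ∖ S`) gives the SAME statement for `D` itself (§2).  Feeding this
into (F) and (c-i): **if only finitely many `x ∈ A(k)` satisfy `t_x(Supp D) = Supp D`, then `D` is ample** (§3) — Mumford's
Application 1 «`H(D)` finite ⇒ `D` ample» in set-stabiliser form, with no irreducibility hypothesis.

## What is proved
§1 `CartierDivisor.IsEffective.compl_nonvanishing_one_eq_biUnion_closure` (regular integral
Noetherian `X`: `X ∖ X_1 = ⋃_{ζ ∈ divisorialPoints 𝒪(−D)} cl{ζ}`) and `….closure_subset_compl_nonvanishing_one`; §2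
`AbelianVariety.image_translation_support_eq_of_subset_preimage_of_translationLemma`; §3
**`AbelianVariety.isAmple_of_isEffective_of_finite_setStabilizer_of_translationLemma`** (the translation lemma for irreducible supports
enters as the hypothesis `hH`, letter (H) quantified over the divisor — discharged by name once (H) is ★).  COUNT-NEUTRAL.  HC_CM is proved
only modulo the 7 printed citations until rung 0 closes; this file moves no book by itself.

Ed. 2 (§5, append-only): the UNCONDITIONAL heads `image_translation_support_eq_of_subset_preimage'`,
**`isAmple_of_isEffective_of_finite_setStabilizer`**, **`isAmple_of_isEffective_of_finite_componentStabilizer`** — `hH` discharged by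
★ `Motives/AbelianVarietyTranslationLemma` (`AbelianVariety.image_translation_support_eq_of_subset_preimage`, A-p06 (g16)).

## References
* [MumfordAV1970] D. Mumford, *Abelian Varieties* (1970), §6 Application 1 and its proof (pp. 60–61).
* [Hartshorne1977] R. Hartshorne, *Algebraic Geometry* (1977), II.6 Prop. 6.11 and Remark 6.11.2 (pp. 141–142).
* [CossartPiltant2008] V. Cossart, O. Piltant, *Resolution of singularities of threefolds in positive characteristic I* (2008), proof of Prop. 4.2
  (the divisorial part of an ideal).
-/

set_option autoImplicit false

noncomputable section

open CategoryTheory AlgebraicGeometry TopologicalSpace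

universe u

namespace Literature.AlgebraicGeometry.Motives

/-! ## §1 The support of an effective Cartier divisor on a regular scheme is the union of its prime components -/

namespace CartierDivisor

open Literature.AlgebraicGeometry.Resolution Scheme.IdealSheafData

variable {X : Scheme.{u}}

/-- The support of a finite product of ideal sheaves is the union of the supports (Mathlib `support_mul`, by induction). [folklore] -/
private theorem coe_support_finset_prod {ι : Type*} (s : Finset ι) (J : ι → X.IdealSheafData) :
    ((∏ i ∈ s, J i).support : Set X) = ⋃ i ∈ s, ((J i).support : Set X) := by
  classical
  induction s using Finset.induction_on with
  | empty =>
    rw [Finset.prod_empty, Scheme.IdealSheafData.one_eq_top, Scheme.IdealSheafData.support_top, Closeds.coe_bot]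
    simp
  | insert a s ha ih =>
    rw [Finset.prod_insert ha, Scheme.IdealSheafData.support_mul, Closeds.coe_sup, ih]
    simp

variable [IsIntegral X] [IsNoetherian X] {D : CartierDivisor X}

/-- **`Supp D = ⋃_ζ cl{ζ}` over the codimension-one points of `Supp D`** for an effective Cartier divisor on a regular integral
Noetherian scheme: `𝒪_X(−D)` is invertible, hence equal to its divisorial part `∏_ζ 𝓘_{cl ζ}^{a_ζ}` (`a_ζ ≥ 1`) over the finitely many
`ζ ∈ Supp D` of codimension one (★ `Resolution.isLocallyPrincipal_iff_codimTwoPart_eq_top`, `divisorialPart_mul_codimTwoPart`,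
`divisorialPart_eq`), whose support is `⋃_ζ cl{ζ}`.  Hartshorne II.6.11: on a locally factorial scheme an effective Cartier divisor is
the Weil divisor `∑_ζ a_ζ · cl{ζ}`. [cite: Hartshorne1977, II.6 Prop. 6.11 and Remark 6.11.2 (pp. 141–142)] [cite: CossartPiltant2008, proof of Prop. 4.2] -/
theorem IsEffective.compl_nonvanishing_one_eq_biUnion_closure (hX : Scheme.IsRegular X) (hD : D.IsEffective) :
    (D.nonvanishing 1)ᶜ = ⋃ ζ ∈ divisorialPoints hD.idealSheaf, closure {ζ} := by
  classical
  haveI : Nonempty X := ⟨genericPoint X⟩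
  set I := hD.idealSheaf with hIdef
  have hI : IsEffectiveCartier I := hD.isEffectiveCartier_idealSheaf
  have hI0 : I ≠ ⊥ := hI.ne_bot_of_nonempty
  -- `I` is its divisorial part
  have hcod : codimTwoPart I = ⊤ := (isLocallyPrincipal_iff_codimTwoPart_eq_top hX hI0).mp hI.isLocallyPrincipal
  have hIH : I = divisorialPart I := by
    have h := divisorialPart_mul_codimTwoPart hX hI0
    rw [hcod, ← Scheme.IdealSheafData.one_eq_top, mul_one] at h
    exact h.symm
  have hfin := finite_divisorialPoints hI0
  -- every exponent is positive
  have hpos : ∀ ζ ∈ divisorialPoints I, (idealOrder I ζ).toNat ≠ 0 := by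
    intro ζ hζ h0
    have h1 := stalkIdeal_eq_pow_of_mem_divisorialPoints hX hI0 hζ
    rw [h0, pow_zero, Ideal.one_eq_top] at h1
    have h2 := (mem_support_iff_stalkIdeal_le I ζ).mp hζ.1
    rw [h1, top_le_iff] at h2
    exact (IsLocalRing.maximalIdeal.isMaximal (X.presheaf.stalk ζ)).ne_top h2
  rw [← hD.coe_support_idealSheaf, ← hIdef]
  conv_lhs => rw [hIH, divisorialPart_eq hfin]
  rw [coe_support_finset_prod]
  ext x
  simp only [Set.mem_iUnion, Set.Finite.mem_toFinset, exists_prop]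
  constructor
  · rintro ⟨ζ, hζ, hx⟩
    refine ⟨ζ, hζ, ?_⟩
    rwa [Scheme.IdealSheafData.support_pow _ _ (hpos ζ hζ), coe_support_primeDivisorIdeal] at hx
  · rintro ⟨ζ, hζ, hx⟩
    refine ⟨ζ, hζ, ?_⟩
    rwa [Scheme.IdealSheafData.support_pow _ _ (hpos ζ hζ), coe_support_primeDivisorIdeal]

/-- Each prime component `cl{ζ}` (`ζ` a codimension-one point of `Supp D`) lies in `Supp D`. [cite: Hartshorne1977, II.6 Prop. 6.11 and Remark 6.11.2 (pp. 141–142)] -/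
theorem IsEffective.closure_subset_compl_nonvanishing_one (hX : Scheme.IsRegular X) (hD : D.IsEffective) {ζ : X}
    (hζ : ζ ∈ divisorialPoints hD.idealSheaf) : closure {ζ} ⊆ (D.nonvanishing 1)ᶜ := by
  rw [hD.compl_nonvanishing_one_eq_biUnion_closure hX]
  exact Set.subset_biUnion_of_mem (u := fun ζ => closure {ζ}) hζ

/-- The prime divisor `[cl ζ]` of a codimension-one point of `Supp D` has support `cl{ζ}` (★ `compl_nonvanishing_one_ofIsEffectiveCartier`,
★ `coe_support_primeDivisorIdeal`). [cite: Hartshorne1977, II.6 Prop. 6.11 and Remark 6.11.2 (pp. 141–142)] -/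
theorem compl_nonvanishing_one_prime_eq_closure (hX : Scheme.IsRegular X) {ζ : X} (h1 : Order.coheight ζ = 1) :
    ((ofIsEffectiveCartier (primeDivisorIdeal ζ) (isEffectiveCartier_primeDivisorIdeal_of_isRegular hX h1)).nonvanishing 1)ᶜ =
      closure {ζ} := by
  rw [compl_nonvanishing_one_ofIsEffectiveCartier, coe_support_primeDivisorIdeal]

end CartierDivisor

/-! ## §2 The translation lemma without the irreducibility hypothesis -/

namespace AbelianVariety

open CartierDivisor Literature.AlgebraicGeometry.Resolution

variable {k : Type u} [Field k] (A : AbelianVariety k)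

/-- **The translation lemma (H) for an ARBITRARY effective divisor, granted (H) for divisors with irreducible support.**  If `Z ⊆ A` is
closed irreducible with `Z ⊆ t_y⁻¹(A ∖ Supp D)` for some `y ∈ A(k)`, then `t_{z z′⁻¹}(Supp D) = Supp D` for all `z, z′ ∈ Z(k)`:
`Supp D = ⋃_ζ cl{ζ}` (§1) and `A ∖ Supp D ⊆ A ∖ cl{ζ}`, so (H) for the prime divisor `[cl ζ]` gives `t_{zz′⁻¹}(cl{ζ}) = cl{ζ}` for
every component. [cite: MumfordAV1970, §6 Application 1 and its proof (pp. 60–61)] -/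
theorem image_translation_support_eq_of_subset_preimage_of_translationLemma
    (hH : ∀ (D' : CartierDivisor A.X.left), D'.IsEffective → IsIrreducible (D'.nonvanishing 1)ᶜ →
      ∀ (Z : Set A.X.left), IsClosed Z → IsIrreducible Z → ∀ (y : A.Points k),
        Z ⊆ (A.translation y).left.base ⁻¹' (D'.nonvanishing 1) → ∀ (z z' : A.Points k), z.pt ∈ Z → z'.pt ∈ Z →
          (A.translation (z * z'⁻¹)).left.base '' (D'.nonvanishing 1)ᶜ = (D'.nonvanishing 1)ᶜ)
    {D : CartierDivisor A.X.left} (hD : D.IsEffective) {Z : Set A.X.left} (hZc : IsClosed Z) (hZi : IsIrreducible Z)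
    (y : A.Points k) (hy : Z ⊆ (A.translation y).left.base ⁻¹' (D.nonvanishing 1)) {z z' : A.Points k}
    (hz : z.pt ∈ Z) (hz' : z'.pt ∈ Z) :
    (A.translation (z * z'⁻¹)).left.base '' (D.nonvanishing 1)ᶜ = (D.nonvanishing 1)ᶜ := by
  haveI : IsNoetherian A.X.left := A.isNoetherian_left
  have hX : Scheme.IsRegular A.X.left := fun x => A.isRegularLocalRing_stalk x
  rw [hD.compl_nonvanishing_one_eq_biUnion_closure hX, Set.image_iUnion₂]
  refine Set.iUnion₂_congr fun ζ hζ => ?_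
  -- the prime divisor of the component `cl{ζ}`
  have h1 : Order.coheight ζ = 1 := hζ.2
  have hsupp := compl_nonvanishing_one_prime_eq_closure hX h1
  have hirr : IsIrreducible ((ofIsEffectiveCartier (primeDivisorIdeal ζ)
      (isEffectiveCartier_primeDivisorIdeal_of_isRegular hX h1)).nonvanishing 1)ᶜ := by
    rw [hsupp]
    exact isIrreducible_singleton.closure
  -- `A ∖ Supp D ⊆ A ∖ cl{ζ}`
  have hsub : D.nonvanishing 1 ⊆ (ofIsEffectiveCartier (primeDivisorIdeal ζ)
      (isEffectiveCartier_primeDivisorIdeal_of_isRegular hX h1)).nonvanishing 1 := by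
    rw [← Set.compl_subset_compl, hsupp]
    exact hD.closure_subset_compl_nonvanishing_one hX hζ
  have hyζ : Z ⊆ (A.translation y).left.base ⁻¹' ((ofIsEffectiveCartier (primeDivisorIdeal ζ)
      (isEffectiveCartier_primeDivisorIdeal_of_isRegular hX h1)).nonvanishing 1) :=
    hy.trans (Set.preimage_mono hsub)
  have h := hH _ (isEffective_ofIsEffectiveCartier _ _) hirr Z hZc hZi y hyζ z z' hz hz'
  rwa [hsupp] at h

/-! ## §3 Mumford §6 Application 1 without the irreducibility hypothesis -/

/-- **Mumford, *Abelian Varieties* §6 Application 1 («`H(D)` finite ⇒ `D` ample»), set-stabiliser form, for an ARBITRARY effective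
divisor** — granted the translation lemma (H) for divisors with irreducible support (hypothesis `hH`, the letter of
`Motives/AbelianVarietyTranslationLemma` quantified over the divisor): if `D ≥ 0` on the abelian variety `A` over `k = k̄` and only
finitely many `x ∈ A(k)` satisfy `t_x(Supp D) = Supp D`, then `D` is ample.  Assembly: the linear-system half ★
`isAmple_of_isEffective_of_forall_isFinite` ((c-i): `|2D|` is base-point free by the theorem of the square and `φ = φ_{2D}` is proper with
closed fibres inside translates of `A ∖ Supp D`; `φ` finite ⇒ `X_{s}` affine ⇒ ample) and the finiteness half ★
`isFinite_of_preimage_subset_translate_of_translationLemma` ((F)), fed with §2. [cite: MumfordAV1970, §6 Application 1 and its proof (pp. 60–61)] -/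
theorem isAmple_of_isEffective_of_finite_setStabilizer_of_translationLemma [IsAlgClosed k]
    (hH : ∀ (D' : CartierDivisor A.X.left), D'.IsEffective → IsIrreducible (D'.nonvanishing 1)ᶜ →
      ∀ (Z : Set A.X.left), IsClosed Z → IsIrreducible Z → ∀ (y : A.Points k),
        Z ⊆ (A.translation y).left.base ⁻¹' (D'.nonvanishing 1) → ∀ (z z' : A.Points k), z.pt ∈ Z → z'.pt ∈ Z →
          (A.translation (z * z'⁻¹)).left.base '' (D'.nonvanishing 1)ᶜ = (D'.nonvanishing 1)ᶜ)
    {D : CartierDivisor A.X.left} (hD : D.IsEffective)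
    (hstab : {x : A.Points k | (A.translation x).left.base '' (D.nonvanishing 1)ᶜ = (D.nonvanishing 1)ᶜ}.Finite) :
    D.IsAmple :=
  A.isAmple_of_isEffective_of_forall_isFinite hD fun _ φ _ _ hcov =>
    A.isFinite_of_preimage_subset_translate_of_translationLemma D
      (fun _ hZc hZi y hy _ _ hz hz' =>
        A.image_translation_support_eq_of_subset_preimage_of_translationLemma hH hD hZc hZi y hy hz hz')
      hstab φ hcov

/-! ## §4 Component stabilisers: finitely many `x` fixing every prime component ⇒ finitely many `x` fixing `Supp D` -/

section Components

variable {D : CartierDivisor A.X.left}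

/-- `t_{x⁻¹}(t_x p) = p` on points. [folklore] -/
private theorem translation_inv_base_translation_base (x : A.Points k) (p : A.X.left) :
    (A.translation x⁻¹).left.base ((A.translation x).left.base p) = p := by
  change ((A.translation x ≫ A.translation x⁻¹).left.base) p = p
  rw [translation_comp_translation_inv]
  rfl

/-- `t_x(t_{x⁻¹} p) = p` on points. [folklore] -/
private theorem translation_base_translation_inv_base (x : A.Points k) (p : A.X.left) :
    (A.translation x).left.base ((A.translation x⁻¹).left.base p) = p := by
  change ((A.translation x⁻¹ ≫ A.translation x).left.base) p = p
  rw [translation_inv_comp_translation]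
  rfl

/-- `t_{x' x⁻¹}(p) = t_{x'}(t_{x⁻¹} p)` on points (★ `translation_comp`). [folklore] -/
private theorem translation_mul_inv_base (x x' : A.Points k) (p : A.X.left) :
    (A.translation (x' * x⁻¹)).left.base p = (A.translation x').left.base ((A.translation x⁻¹).left.base p) := by
  rw [← A.translation_comp x⁻¹ x']
  rfl

/-- A translation preserves the codimension of points (it is an automorphism; Mathlib `Order.coheight_orderIso` on the
specialisation order). [folklore] -/
private theorem coheight_translation_base (x : A.Points k) (p : A.X.left) :
    Order.coheight ((A.translation x).left.base p) = Order.coheight p := by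
  let f : ↥A.X.left ≃o ↥A.X.left :=
    { toFun := (A.translation x).left.base
      invFun := (A.translation x⁻¹).left.base
      left_inv := fun a => A.translation_inv_base_translation_base x a
      right_inv := fun b => A.translation_base_translation_inv_base x b
      map_rel_iff' := fun {a b} => by
        change (A.translation x).left.base a ≤ (A.translation x).left.base b ↔ a ≤ b
        rw [Scheme.le_iff_specializes, Scheme.le_iff_specializes]
        exact (A.translation x).left.isOpenEmbedding.toIsEmbedding.toIsInducing.specializes_iff }
  exact Order.coheight_orderIso f p

/-- A translation carries `cl{ζ}` to `cl{t_x ζ}` (it is a homeomorphism). [folklore] -/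
private theorem image_translation_closure_singleton (x : A.Points k) (ζ : A.X.left) :
    (A.translation x).left.base '' closure {ζ} = closure {(A.translation x).left.base ζ} := by
  have h := (Scheme.Hom.homeomorph (A.translation x).left).image_closure {ζ}
  rw [Set.image_singleton] at h
  exact h

/-- If `t_x(Supp D) = Supp D` then `t_{x⁻¹}(Supp D) = Supp D`. [folklore] -/
private theorem image_translation_inv_eq {x : A.Points k} {S : Set A.X.left}
    (hx : (A.translation x).left.base '' S = S) : (A.translation x⁻¹).left.base '' S = S := by
  have hcomp : ((A.translation x⁻¹).left.base ∘ (A.translation x).left.base : A.X.left → A.X.left) = id :=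
    funext fun p => A.translation_inv_base_translation_base x p
  conv_lhs => rw [← hx]
  rw [← Set.image_comp, hcomp, Set.image_id]

/-- A translation fixing `Supp D` permutes the codimension-one points of `Supp D`. [cite: MumfordAV1970, §6 Application 1 and its proof (pp. 60–61)] -/
theorem translation_base_mem_divisorialPoints (hD : D.IsEffective) {x : A.Points k}
    (hx : (A.translation x).left.base '' (D.nonvanishing 1)ᶜ = (D.nonvanishing 1)ᶜ) {ζ : A.X.left}
    (hζ : ζ ∈ divisorialPoints hD.idealSheaf) : (A.translation x).left.base ζ ∈ divisorialPoints hD.idealSheaf := by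
  refine ⟨?_, by rw [A.coheight_translation_base]; exact hζ.2⟩
  have h1 : ζ ∈ (D.nonvanishing 1)ᶜ := by rw [← hD.coe_support_idealSheaf]; exact hζ.1
  have h2 : (A.translation x).left.base ζ ∈ (D.nonvanishing 1)ᶜ := by rw [← hx]; exact ⟨ζ, h1, rfl⟩
  rw [← hD.coe_support_idealSheaf] at h2
  exact h2

/-- **Finitely many `x` fixing every prime component of `Supp D` ⇒ finitely many `x` fixing `Supp D`.**  A translation `t_x` fixing
`Supp D` permutes the finitely many codimension-one points `ζ` of `Supp D` (★ `Resolution.finite_divisorialPoints`); two such `x, x₀`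
inducing the same permutation differ by `x x₀⁻¹` fixing every `cl{ζ}`; so the set-stabiliser is a finite union (over the finitely many
maps `ζ ↦ t_x ζ`) of translates of the component stabiliser. [cite: MumfordAV1970, §6 Application 1 and its proof (pp. 60–61)] -/
theorem finite_setStabilizer_of_finite_componentStabilizer (hD : D.IsEffective)
    (hfin : {x : A.Points k | ∀ ζ ∈ divisorialPoints hD.idealSheaf,
      (A.translation x).left.base '' closure {ζ} = closure {ζ}}.Finite) :
    {x : A.Points k | (A.translation x).left.base '' (D.nonvanishing 1)ᶜ = (D.nonvanishing 1)ᶜ}.Finite := by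
  classical
  haveI : IsNoetherian A.X.left := A.isNoetherian_left
  haveI : Nonempty A.X.left := ⟨genericPoint A.X.left⟩
  set T : Set A.X.left := divisorialPoints hD.idealSheaf with hT
  have hTfin : T.Finite := finite_divisorialPoints hD.isEffectiveCartier_idealSheaf.ne_bot_of_nonempty
  haveI : Finite T := hTfin.to_subtype
  set St : Set (A.Points k) :=
    {x : A.Points k | (A.translation x).left.base '' (D.nonvanishing 1)ᶜ = (D.nonvanishing 1)ᶜ} with hSt
  -- the permutation of `T` induced by `x ∈ St`, as a map `T → A`
  let Φ : A.Points k → (T → A.X.left) := fun x ζ => (A.translation x).left.base ζ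
  -- its image is finite: it lies in the range of `(T → T) → (T → A)`
  have himg : (Φ '' St).Finite := by
    refine (Set.finite_range (fun g : T → T => fun ζ => ((g ζ : T) : A.X.left))).subset ?_
    rintro _ ⟨x, hx, rfl⟩
    exact ⟨fun ζ => ⟨(A.translation x).left.base ζ, A.translation_base_mem_divisorialPoints hD hx ζ.2⟩, rfl⟩
  -- each fibre of `Φ` on `St` is a translate of the component stabiliser
  have hfib : ∀ x₀ ∈ St, (St ∩ Φ ⁻¹' {Φ x₀}).Finite := by
    intro x₀ hx₀
    refine (hfin.preimage (mul_left_injective x₀⁻¹).injOn).subset ?_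
    rintro x ⟨hx, hxΦ⟩
    have hxΦ : Φ x = Φ x₀ := hxΦ
    change ∀ ζ ∈ divisorialPoints hD.idealSheaf, (A.translation (x * x₀⁻¹)).left.base '' closure {ζ} = closure {ζ}
    intro ζ hζ
    -- `ζ' := t_{x₀⁻¹} ζ` is again a codimension-one point of `Supp D`
    have hζ' : (A.translation x₀⁻¹).left.base ζ ∈ T :=
      A.translation_base_mem_divisorialPoints hD (A.image_translation_inv_eq hx₀) hζ
    have hΦζ' := congrFun hxΦ ⟨_, hζ'⟩
    change (A.translation x).left.base ((A.translation x₀⁻¹).left.base ζ) =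
      (A.translation x₀).left.base ((A.translation x₀⁻¹).left.base ζ) at hΦζ'
    rw [A.image_translation_closure_singleton, A.translation_mul_inv_base, hΦζ',
      A.translation_base_translation_inv_base]
  -- assemble
  refine (himg.biUnion fun f hf => ?_ : (⋃ f ∈ Φ '' St, St ∩ Φ ⁻¹' {f}).Finite).subset fun x hx =>
    Set.mem_biUnion (Set.mem_image_of_mem Φ hx) ⟨hx, rfl⟩
  obtain ⟨x₀, hx₀, rfl⟩ := hf
  exact hfib x₀ hx₀

/-- **Mumford §6 Application 1 with the COMPONENT stabiliser**, granted the translation lemma for irreducible supports: if `D ≥ 0` and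
only finitely many `x ∈ A(k)` satisfy `t_x(cl{ζ}) = cl{ζ}` for every codimension-one point `ζ` of `Supp D` (every prime component of
`Supp D`), then `D` is ample. [cite: MumfordAV1970, §6 Application 1 and its proof (pp. 60–61)] -/
theorem isAmple_of_isEffective_of_finite_componentStabilizer_of_translationLemma [IsAlgClosed k]
    (hH : ∀ (D' : CartierDivisor A.X.left), D'.IsEffective → IsIrreducible (D'.nonvanishing 1)ᶜ →
      ∀ (Z : Set A.X.left), IsClosed Z → IsIrreducible Z → ∀ (y : A.Points k),
        Z ⊆ (A.translation y).left.base ⁻¹' (D'.nonvanishing 1) → ∀ (z z' : A.Points k), z.pt ∈ Z → z'.pt ∈ Z →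
          (A.translation (z * z'⁻¹)).left.base '' (D'.nonvanishing 1)ᶜ = (D'.nonvanishing 1)ᶜ)
    (hD : D.IsEffective)
    (hfin : {x : A.Points k | ∀ ζ ∈ divisorialPoints hD.idealSheaf,
      (A.translation x).left.base '' closure {ζ} = closure {ζ}}.Finite) :
    D.IsAmple :=
  A.isAmple_of_isEffective_of_finite_setStabilizer_of_translationLemma hH hD
    (A.finite_setStabilizer_of_finite_componentStabilizer hD hfin)

end Components

/-! ## §5 (ed. 2) The unconditional heads: the translation lemma (H) ★ `Motives/AbelianVarietyTranslationLemma` discharges `hH` -/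

section Unconditional

variable [IsAlgClosed k] {D : CartierDivisor A.X.left}

/-- **Mumford's translation lemma for an ARBITRARY effective divisor** (no irreducibility of `Supp D`): if `Z ⊆ A` is closed
irreducible with `Z ⊆ t_y⁻¹(A ∖ Supp D)`, then `t_{z z′⁻¹}(Supp D) = Supp D` for all `z, z′ ∈ Z(k)` — §2 with `hH` := ★
`image_translation_support_eq_of_subset_preimage` (A-p06, (H)) applied to each prime component. [cite: MumfordAV1970, §6 Application 1 and its proof (pp. 60–61)] -/
theorem image_translation_support_eq_of_subset_preimage' (hD : D.IsEffective) {Z : Set A.X.left} (hZc : IsClosed Z)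
    (hZi : IsIrreducible Z) (y : A.Points k) (hy : Z ⊆ (A.translation y).left.base ⁻¹' (D.nonvanishing 1))
    {z z' : A.Points k} (hz : z.pt ∈ Z) (hz' : z'.pt ∈ Z) :
    (A.translation (z * z'⁻¹)).left.base '' (D.nonvanishing 1)ᶜ = (D.nonvanishing 1)ᶜ :=
  A.image_translation_support_eq_of_subset_preimage_of_translationLemma
    (fun _ hD' hirr _ hZc' hZi' y' hy' _ _ hz₁ hz₂ =>
      A.image_translation_support_eq_of_subset_preimage hD' hirr hZc' hZi' y' hy' hz₁ hz₂)
    hD hZc hZi y hy hz hz'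

/-- **Mumford, *Abelian Varieties* §6 Application 1, set-stabiliser form, UNCONDITIONAL**: an effective divisor `D` on an abelian
variety over `k = k̄` such that only finitely many `x ∈ A(k)` satisfy `t_x(Supp D) = Supp D` is ample. [cite: MumfordAV1970, §6 Application 1 and its proof (pp. 60–61)] -/
theorem isAmple_of_isEffective_of_finite_setStabilizer (hD : D.IsEffective)
    (hstab : {x : A.Points k | (A.translation x).left.base '' (D.nonvanishing 1)ᶜ = (D.nonvanishing 1)ᶜ}.Finite) :
    D.IsAmple :=
  A.isAmple_of_isEffective_of_finite_setStabilizer_of_translationLemma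
    (fun _ hD' hirr _ hZc hZi y hy _ _ hz hz' =>
      A.image_translation_support_eq_of_subset_preimage hD' hirr hZc hZi y hy hz hz')
    hD hstab

/-- **Mumford §6 Application 1, component-stabiliser form, UNCONDITIONAL**: an effective divisor `D` such that only finitely many
`x ∈ A(k)` fix every prime component `cl{ζ}` of `Supp D` is ample. [cite: MumfordAV1970, §6 Application 1 and its proof (pp. 60–61)] -/
theorem isAmple_of_isEffective_of_finite_componentStabilizer (hD : D.IsEffective)
    (hfin : {x : A.Points k | ∀ ζ ∈ divisorialPoints hD.idealSheaf,
      (A.translation x).left.base '' closure {ζ} = closure {ζ}}.Finite) :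
    D.IsAmple :=
  A.isAmple_of_isEffective_of_finite_componentStabilizer_of_translationLemma
    (fun _ hD' hirr _ hZc hZi y hy _ _ hz hz' =>
      A.image_translation_support_eq_of_subset_preimage hD' hirr hZc hZi y hy hz hz')
    hD hfin

end Unconditional

end AbelianVariety

end Literature.AlgebraicGeometry.Motives

end
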